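import Mathlib
import HarnessLib
import Summits.Ventures.LatticeQCDFlow.Scaling.GiniMeanDifferenceCLT
import Summits.Ventures.LatticeQCDFlow.Scaling.IdentityFlowAcceptanceDiagonalLimit
import Summits.Ventures.LatticeQCDFlow.Scaling.KurtosisIndependentSum
import Summits.Ventures.LatticeQCDFlow.Scaling.SU2IdentityFlowSlopeVolumeSandwich
import Summits.Ventures.LatticeQCDFlow.Scaling.IdentityFlowStrongCoupling

/-!
# LatticeQCDFlow / Scaling — the exact large-volume laws of the untrained U(1) and SU(2) samplers:
# slope constants `s_V/√V → 1/√(2π)`, `1/(2√π)` and diagonal profiles `erfc(|c|/(2√2))`, `erfc(|c|/4)`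

HONEST FRAMING: exact (Metropolis-corrected) sampling algorithms for lattice gauge theory;
figures of merit are autocorrelation/cost numbers at stated couplings and volumes; no
continuum-physics claim.

Venture `LatticeQCDFlow` (cell pub-lqcd), topic `Scaling`; FANOUT row 3 (`s0-u1-a`, S0-B
implementation A, GEN-19).  NEW WORK of the cell (assembly), not a published result; NO definition
is introduced; nothing is cited.  Parents (in the tree): row 3's `Scaling/GiniMeanDifferenceCLT`
(`s_V/√V → σ/√π` for every square-integrable block statistic),
`Scaling/IdentityFlowAcceptanceDiagonalLimit` (`acc_V(c/√V) → erfc(|c|σ/2)` for every bounded block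
statistic), `Scaling/KurtosisIndependentSum`
(one-angle Haar moments `E cos = 0`, `E cos² = ½`) and `Scaling/SU2IdentityFlowSlopeVolumeSandwich`
(the SU(2) class-angle law `ν₂ = (2/π) sin²α dα`: `E cos = 0`, `E cos² = ¼`; and the sandwich
`√(V/24) ≤ s_V ≤ √(V/12)`).

Setting and reading: `s_V = ½·E|T_V − T_V′|`, `T_V = Σᵢ cos θᵢ` over `V = n` i.i.d. angles, is the
strong-coupling acceptance slope `lim_{β→0⁺}(1 − acc_V(β))/β` of the untrained factorised sampler
(row 3 GEN-17 (D)/(N)/(O); that identification is not restated here).  GEN-18 proved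
`√(V/12) ≤ s_V ≤ √(V/6)` (U(1)) and `√(V/24) ≤ s_V ≤ √(V/12)` (SU(2)).  Here:

* **`u1Pi_slope_div_sqrt_tendsto`** — U(1): `s_V/√V → 1/√(2π)`;
  `u1_slopeConstant_bounds` — `0.3989 < 1/√(2π) < 0.399`, and
  `u1_slopeConstant_mem_sandwich` — `√(1/12) < 1/√(2π) < √(1/6)` (the limit sits `2.3 %` under
  GEN-18's Glasser ceiling `1/√6 ≈ 0.408` and `38 %` above the Lyapunov floor `1/√12 ≈ 0.289`);
* **`su2Pi_slope_div_sqrt_tendsto`** — SU(2) class angles: `s_V/√V → 1/(2√π)`;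
  `su2_slopeConstant_bounds` — `0.282 < 1/(2√π) < 0.2821`; `su2_slopeConstant_mem_sandwich` —
  `√(1/24) < 1/(2√π) < √(1/12)`;
* `u1_su2_slopeConstant_ratio` — the two constants differ by exactly `√2`;
* **`u1Pi_meanAccept_diag_tendsto`** — U(1), coupling `β = c/√V` (`c ≠ 0`): the acceptance of the
  untrained sampler converges to `(2/√π)∫_{|c|/(2√2)}^∞ e^{−u²}du = erfc(|c|/(2√2))`;
  **`su2Pi_meanAccept_diag_tendsto`** — SU(2) class angles: `→ erfc(|c|/4)`.

Reading (value-free): to first order in `β` the acceptance deficit of the untrained sampler is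
`β√(V/(2π))·(1 + o(1))` (U(1)), `β√(V/(4π))·(1 + o(1))` (SU(2)) as `V → ∞`; on the diagonal
`β√V = c` the acceptance has the non-trivial limit `erfc(|c|/(2√2))` (U(1)), `erfc(|c|/4)` (SU(2)) —
the log-normal law at log-weight variance `c²/2`, `c²/4`.  NOT CLAIMED: a rate in `V`; the torus
(one global constraint); any value at the cell's `(β, L)`; nothing re-scored.
-/

noncomputable section

namespace Summit.Ventures.LatticeQCDFlow.Theory2

open MeasureTheory ProbabilityTheory Filter Finset Real Set
open scoped Topology

/-! ## §1 U(1): `s_V/√V → 1/√(2π)` -/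

section U1

/-- **U(1): THE EXACT CONSTANT OF THE `√V` LAW.**  For the untrained factorised U(1) sampler the
strong-coupling slope satisfies `s_V/√V → 1/√(2π) ≈ 0.399` (`σ² = Var cos = ½`, `σ/√π`). [ours] -/
theorem u1Pi_slope_div_sqrt_tendsto :
    Tendsto (fun n : ℕ => (1 / 2 * ∫ x, ∫ x', |∑ i, Real.cos (x i) - ∑ i, Real.cos (x' i)|
        ∂(Measure.pi fun _ : Fin n => (ENNReal.ofReal (2 * π))⁻¹ • volume.restrict (Ioc (0 : ℝ) (2 * π)))
        ∂(Measure.pi fun _ : Fin n => (ENNReal.ofReal (2 * π))⁻¹ • volume.restrict (Ioc (0 : ℝ) (2 * π))))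
          / Real.sqrt n)
      atTop (𝓝 (1 / Real.sqrt (2 * π))) := by
  haveI : IsProbabilityMeasure ((ENNReal.ofReal (2 * π))⁻¹ • volume.restrict (Ioc (0 : ℝ) (2 * π))) :=
    ⟨by rw [Measure.smul_apply, Measure.restrict_apply_univ, Real.volume_Ioc, sub_zero, smul_eq_mul,
      ENNReal.inv_mul_cancel (ENNReal.ofReal_pos.2 (by positivity : (0 : ℝ) < 2 * π)).ne'
        ENNReal.ofReal_ne_top]⟩
  have h := pi_halfGini_sum_div_sqrt_tendsto (memLp_four_cos_uniform.mono_exponent (by norm_num))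
  rw [variance_cos_uniform] at h
  have e : Real.sqrt (1 / 2 / π) = 1 / Real.sqrt (2 * π) := by
    rw [div_div, Real.sqrt_div' _ (by positivity), Real.sqrt_one]
  rw [e] at h
  exact h

/-- `0.3989 < 1/√(2π) < 0.399`. [ours] -/
theorem u1_slopeConstant_bounds :
    (0.3989 : ℝ) < 1 / Real.sqrt (2 * π) ∧ 1 / Real.sqrt (2 * π) < 0.399 := by
  have hπ1 := Real.pi_gt_d6
  have hπ2 := Real.pi_lt_d6
  have hs : 0 < Real.sqrt (2 * π) := Real.sqrt_pos.2 (by positivity)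
  constructor
  · rw [lt_div_iff₀ hs, ← lt_div_iff₀' (by norm_num : (0 : ℝ) < 0.3989), Real.sqrt_lt' (by positivity)]
    nlinarith
  · rw [div_lt_iff₀ hs, ← div_lt_iff₀' (by norm_num : (0 : ℝ) < 0.399), Real.lt_sqrt (by positivity)]
    nlinarith

/-- The U(1) constant is STRICTLY inside GEN-18's sandwich: `√(1/12) < 1/√(2π) < √(1/6)`. [ours] -/
theorem u1_slopeConstant_mem_sandwich :
    Real.sqrt (1 / 12) < 1 / Real.sqrt (2 * π) ∧ 1 / Real.sqrt (2 * π) < Real.sqrt (1 / 6) := by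
  obtain ⟨h1, h2⟩ := u1_slopeConstant_bounds
  constructor
  · refine lt_trans ?_ h1
    rw [Real.sqrt_lt' (by norm_num)]; norm_num
  · refine lt_trans h2 ?_
    rw [Real.lt_sqrt (by norm_num)]; norm_num

end U1

/-! ## §2 SU(2) class angles: `s_V/√V → 1/(2√π)` -/

section SU2

/-- `Var(cos α) = ¼` under the SU(2) class-angle law `(2/π) sin²α dα`. [ours] -/
theorem su2ClassOne_variance_cos :
    Var[fun α => Real.cos α; (volume.restrict (Ioc (0 : ℝ) π)).withDensity
        fun α => ENNReal.ofReal (2 / π * Real.sin α ^ 2)] = 1 / 4 := by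
  haveI := su2ClassOne_isProbabilityMeasure
  obtain ⟨h1, h2, -⟩ := cos_su2ClassOne_moments
  rw [variance_eq_sub (memLp_four_cos_su2ClassOne.mono_exponent (by norm_num))]
  simp only [Pi.pow_apply]
  rw [h2, h1]
  norm_num

/-- **SU(2): THE EXACT CONSTANT OF THE `√V` LAW.**  For the untrained factorised SU(2) class-angle
sampler, `s_V/√V → 1/(2√π) ≈ 0.282` (`σ² = ¼`). [ours] -/
theorem su2Pi_slope_div_sqrt_tendsto :
    Tendsto (fun n : ℕ => (1 / 2 * ∫ x, ∫ x', |∑ i, Real.cos (x i) - ∑ i, Real.cos (x' i)|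
        ∂(Measure.pi fun _ : Fin n => (volume.restrict (Ioc (0 : ℝ) π)).withDensity
          fun α => ENNReal.ofReal (2 / π * Real.sin α ^ 2))
        ∂(Measure.pi fun _ : Fin n => (volume.restrict (Ioc (0 : ℝ) π)).withDensity
          fun α => ENNReal.ofReal (2 / π * Real.sin α ^ 2))) / Real.sqrt n)
      atTop (𝓝 (1 / (2 * Real.sqrt π))) := by
  haveI := su2ClassOne_isProbabilityMeasure
  have h := pi_halfGini_sum_div_sqrt_tendsto (memLp_four_cos_su2ClassOne.mono_exponent (by norm_num))
  rw [su2ClassOne_variance_cos] at h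
  have e : Real.sqrt (1 / 4 / π) = 1 / (2 * Real.sqrt π) := by
    rw [div_div, Real.sqrt_div' _ (by positivity), Real.sqrt_one,
      show (4 : ℝ) * π = 2 ^ 2 * π by norm_num, Real.sqrt_mul (by norm_num), Real.sqrt_sq zero_le_two]
  rw [e] at h
  exact h

/-- `0.282 < 1/(2√π) < 0.2821`. [ours] -/
theorem su2_slopeConstant_bounds :
    (0.282 : ℝ) < 1 / (2 * Real.sqrt π) ∧ 1 / (2 * Real.sqrt π) < 0.2821 := by
  have hπ1 := Real.pi_gt_d6
  have hπ2 := Real.pi_lt_d6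
  have hs : 0 < Real.sqrt π := Real.sqrt_pos.2 Real.pi_pos
  have hsq := Real.sq_sqrt Real.pi_pos.le
  constructor
  · rw [lt_div_iff₀ (by positivity)]
    nlinarith
  · rw [div_lt_iff₀ (by positivity)]
    nlinarith

/-- The SU(2) constant is STRICTLY inside GEN-18's sandwich: `√(1/24) < 1/(2√π) < √(1/12)`. [ours] -/
theorem su2_slopeConstant_mem_sandwich :
    Real.sqrt (1 / 24) < 1 / (2 * Real.sqrt π) ∧ 1 / (2 * Real.sqrt π) < Real.sqrt (1 / 12) := by
  obtain ⟨h1, h2⟩ := su2_slopeConstant_bounds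
  constructor
  · refine lt_trans ?_ h1
    rw [Real.sqrt_lt' (by norm_num)]; norm_num
  · refine lt_trans h2 ?_
    rw [Real.lt_sqrt (by norm_num)]; norm_num

/-- The U(1) and SU(2) constants differ by exactly the factor `√2`. [ours] -/
theorem u1_su2_slopeConstant_ratio :
    1 / Real.sqrt (2 * π) = Real.sqrt 2 * (1 / (2 * Real.sqrt π)) := by
  have hs2 : Real.sqrt 2 ≠ 0 := (Real.sqrt_pos.2 two_pos).ne'
  have hsp : Real.sqrt π ≠ 0 := (Real.sqrt_pos.2 Real.pi_pos).ne'
  rw [Real.sqrt_mul zero_le_two]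
  field_simp
  rw [Real.sq_sqrt zero_le_two]

end SU2

/-! ## §3 The diagonal profiles `β√V = c` -/

section DiagonalProfiles

/-- **U(1) ON THE DIAGONAL**: for `c ≠ 0` the acceptance of the untrained `V`-plaquette sampler at
coupling `β = c/√V` converges to `erfc(|c|/(2√2)) = (2/√π)∫_{|c|/(2√2)}^∞ e^{−u²} du` — the
log-normal acceptance law at log-weight variance `c²/2`. [ours] -/
theorem u1Pi_meanAccept_diag_tendsto {c : ℝ} (hc : c ≠ 0) :
    Tendsto (fun n : ℕ =>
        (∫ x, ∫ y, min (Real.exp (c / Real.sqrt n * ∑ i, Real.cos (x i)))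
              (Real.exp (c / Real.sqrt n * ∑ i, Real.cos (y i)))
            ∂(Measure.pi fun _ : Fin n => (ENNReal.ofReal (2 * π))⁻¹ • volume.restrict (Ioc (0 : ℝ) (2 * π)))
            ∂(Measure.pi fun _ : Fin n => (ENNReal.ofReal (2 * π))⁻¹ • volume.restrict (Ioc (0 : ℝ) (2 * π))))
          / ∫ x, Real.exp (c / Real.sqrt n * ∑ i, Real.cos (x i))
            ∂(Measure.pi fun _ : Fin n => (ENNReal.ofReal (2 * π))⁻¹ • volume.restrict (Ioc (0 : ℝ) (2 * π))))
      atTop (𝓝 (2 / Real.sqrt Real.pi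
        * ∫ u in Ioi (|c| / (2 * Real.sqrt 2)), Real.exp (-u ^ 2))) := by
  haveI : IsProbabilityMeasure ((ENNReal.ofReal (2 * π))⁻¹ • volume.restrict (Ioc (0 : ℝ) (2 * π))) :=
    ⟨by rw [Measure.smul_apply, Measure.restrict_apply_univ, Real.volume_Ioc, sub_zero, smul_eq_mul,
      ENNReal.inv_mul_cancel (ENNReal.ofReal_pos.2 (by positivity : (0 : ℝ) < 2 * π)).ne'
        ENNReal.ofReal_ne_top]⟩
  obtain ⟨h1, -, -⟩ := cos_uniform_moments
  have hvar := variance_cos_uniform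
  have h := tiltPi_meanAccept_diag_tendsto_erfc (ν := (ENNReal.ofReal (2 * π))⁻¹ •
      volume.restrict (Ioc (0 : ℝ) (2 * π))) (g := fun θ => Real.cos θ) Real.measurable_cos
    (K := 1) (fun θ => Real.abs_cos_le_one θ) h1 hc (by rw [hvar]; norm_num)
  rw [hvar] at h
  have e : Real.sqrt (c ^ 2 * (1 / 2)) / 2 = |c| / (2 * Real.sqrt 2) := by
    rw [Real.sqrt_mul' _ (by norm_num), Real.sqrt_sq_eq_abs, one_div, Real.sqrt_inv]
    field_simp
  rw [e] at h
  exact h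

/-- **SU(2) CLASS ANGLES ON THE DIAGONAL**: for `c ≠ 0` the acceptance of the untrained factorised
SU(2) sampler at `β = c/√V` converges to `erfc(|c|/4) = (2/√π)∫_{|c|/4}^∞ e^{−u²} du` (log-weight
variance `c²/4`). [ours] -/
theorem su2Pi_meanAccept_diag_tendsto {c : ℝ} (hc : c ≠ 0) :
    Tendsto (fun n : ℕ =>
        (∫ x, ∫ y, min (Real.exp (c / Real.sqrt n * ∑ i, Real.cos (x i)))
              (Real.exp (c / Real.sqrt n * ∑ i, Real.cos (y i)))
            ∂(Measure.pi fun _ : Fin n => (volume.restrict (Ioc (0 : ℝ) π)).withDensity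
              fun α => ENNReal.ofReal (2 / π * Real.sin α ^ 2))
            ∂(Measure.pi fun _ : Fin n => (volume.restrict (Ioc (0 : ℝ) π)).withDensity
              fun α => ENNReal.ofReal (2 / π * Real.sin α ^ 2)))
          / ∫ x, Real.exp (c / Real.sqrt n * ∑ i, Real.cos (x i))
            ∂(Measure.pi fun _ : Fin n => (volume.restrict (Ioc (0 : ℝ) π)).withDensity
              fun α => ENNReal.ofReal (2 / π * Real.sin α ^ 2)))
      atTop (𝓝 (2 / Real.sqrt Real.pi * ∫ u in Ioi (|c| / 4), Real.exp (-u ^ 2))) := by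
  haveI := su2ClassOne_isProbabilityMeasure
  obtain ⟨h1, -, -⟩ := cos_su2ClassOne_moments
  have hvar := su2ClassOne_variance_cos
  have h := tiltPi_meanAccept_diag_tendsto_erfc (ν := (volume.restrict (Ioc (0 : ℝ) π)).withDensity
      fun α => ENNReal.ofReal (2 / π * Real.sin α ^ 2)) (g := fun θ => Real.cos θ) Real.measurable_cos
    (K := 1) (fun θ => Real.abs_cos_le_one θ) h1 hc (by rw [hvar]; norm_num)
  rw [hvar] at h
  have e : Real.sqrt (c ^ 2 * (1 / 4)) / 2 = |c| / 4 := by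
    rw [Real.sqrt_mul' _ (by norm_num), Real.sqrt_sq_eq_abs,
      show (1 / 4 : ℝ) = (1 / 2) ^ 2 by norm_num, Real.sqrt_sq (by norm_num)]
    ring
  rw [e] at h
  exact h

end DiagonalProfiles

end Summit.Ventures.LatticeQCDFlow.Theory2

end
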